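import Literature.NumberTheory.Automorphic.Liu2021.ThetaLiftFromLineIrreducible
import HarnessLib

/-!
# Liu 2021, Corollary B.6 (1), SECOND clause, at `(dim W, dim V) = (1, N)` — «`V_π = Θ^V_{(μ⁻¹,ν⁻¹),−W}(Θ^W_{(μ,ν),V}(V_π))`» [Wu2013, Thm. 5.1] —
# as a PREDICATE on the tree's theta-road data: A DISCRETE AUTOMORPHIC `P ⊆ L²([U(H)])` NOT ORTHOGONAL TO THE `(a, ξ)`-THETA CLASSES LIES IN THEIR CLOSED SPAN

Topic `NumberTheory/Automorphic/Liu2021`; namespace `Literature.NumberTheory.Automorphic.Liu2021`.  STATEMENT ONLY (one `def … : Prop` with body + its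
`_iff` unfolding; no `sorry`, no instance, no notation, nothing asserted — a PREDICATE of the frame ∕ line ∕ character data, closed over the CM curve frames
ONLY by a consumer in `Summits/`).  SIBLING of ★ `ThetaLiftFromLineIrreducible` (same file frame, same binders, same theta-class set `S`): that row is the
FIRST clause of [Liu2021, Cor. B.6 (1)] read `W → V` ([Wu2013, Thm. 5.3], irreducibility of the closed theta span); this row is the SECOND clause read
`V → W → V` ([Wu2013, Thm. 5.1], the realisation identity).  Vocabulary = ★ `ThetaLiftFromLineMeets` ∕ ★ `ThetaLiftFromLineCharacters` (`lineThetaKernelDatum`,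
`thetaLiftFun`, `charCM`, `normal_range_toAdelic_JW`), ★ `AutomorphicSpectrum` (`DiscreteAutomorphicRep`, `rightRegular`, `IsAutomorphicMeasure`, `L2`).

THE PREDICATE.  Data as in ★ `ThetaLiftFromLineIrreducible`: CM field `L`, `H ∈ M_N(L)`, real non-zero diagonal `dV`, reindexing `e₁`, a homomorphism
`ιA : U(H)(𝔸_{L⁺}) →* U(diag dV)(𝔸_{L⁺})` (in the consumer: the pinned adelic frame transport), `[U(diag dV)]` compact, an automorphic measure `μA` on `[U(H)]`,
a conjugate-symplectic splitting character `μ`, a line `a ∈ (L⁺)ˣ` (`W = ⟨a⟩`), a continuous unitary character `ξ` of `[U(⟨a⟩)]`; `S ⊆ L²([U(H)], μA)` the set of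
ALL `(a, ξ)`-theta classes `[x ↦ Θ̃_Ψ(ξ)(ιA x)]`.  `ThetaLiftFromLineRealises …` SAYS: for every discrete automorphic representation `P` (an irreducible closed
invariant subspace of the right regular representation, ★ `DiscreteAutomorphicRep`), IF the orthogonal projection `pr_P v` of SOME theta class `v ∈ S` is
non-zero (`P` is not orthogonal to the theta lift of `ξ` from `⟨a⟩` — «`Θ^W_{(μ,ν),V}(V_π) ≠ 0` with `ξ`-component», [Liu2021, Thm. B.4 (1) (c)]), THEN the
carrier of `P` lies in the closed span `S̄` of `S` («`V_π ⊆ Θ^V(ξ)`»).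

PRINT ANCHOR AND SCOPE.  [Liu2021, Cor. B.6 (1), p. 99]: «Suppose that `Θ^W_{(μ,ν),V}(V_π)` is cuspidal. Then (1) the space `Θ^W_{(μ,ν),V}(V_π)` is an
irreducible representation of `U(W)(𝔸_F)`; and `V_π = Θ^V_{(μ⁻¹,ν⁻¹),−W}(Θ^W_{(μ,ν),V}(V_π))`, where `−W` denotes the skew-hermitian space `W, −⟨ , ⟩_W`,
and we naturally identify `U(W)` with `U(−W)`», proof l. 4339: «(eq:pole) follows from [Wu13, Theorem 5.1]» = C. Wu, J. Number Theory 133 (2013), Thm. 5.1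
(for `π` cuspidal on `U(V)` whose lift `Θ_W(π)` to `U(W)` is its first occurrence and cuspidal, `Θ_V(Θ_W(π)) = π` as SPACES of automorphic forms; method:
Rallis' inner product formula in operator form — the doubling integral reproduces the vector, `θ_{φ′}(θ_φ^*(f)) = c · f` up to local zeta operators, with
`c ≠ 0` at first occurrence — via the regularized Siegel–Weil formula [Ichino2004] and [Rallis1984, §1], [Moeglin1997]).  READING at `(1, N)`, `U(V) = U(H)`
ANISOTROPIC (the consumer's definiteness clause ⇒ every automorphic form on `U(H)` and on the torus `U(⟨a⟩)` is cuspidal, so both cuspidality provisos are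
void; `dim W = 1` is the first occurrence as soon as `π` is not a character, and for a character `π` the statement below is checked directly by the
consumer or is not invoked): the lift `Θ^W(V_π)` is an irreducible — hence ONE-dimensional, `U(W)(𝔸)` being abelian — space of automorphic forms on
`[U(⟨a⟩)]`, i.e. the line of ONE automorphic character `ξ₀`; the hypothesis «`pr_P v ≠ 0` for a `(a, ξ)`-theta class `v = T_Ψ ξ`» reads, through the adjunction
`⟨T_Ψ^* f, ξ⟩_{[U(W)]} = ⟨f, T_Ψ ξ⟩_{[U(V)]}` (Fubini on the two compact quotients; `T_Ψ^*` is the lift `V → W` with the conjugate kernel — Liu's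
`(μ⁻¹, ν⁻¹, −W)`), «the `ξ`-coefficient of `Θ^W(V_π)` is non-zero», whence `ξ₀ = ξ`; and the identity `V_π = Θ^V(ℂ ξ₀)` says that the `K`-finite vectors of
`P` are `(a, ξ)`-theta functions, so the carrier of `P` (their `L²`-closure, [BorelJacquet1979, §4.6]) lies in `S̄`.  The row asserts the INCLUSION only
(print has equality; with the sibling row's irreducibility the consumer recovers `P = S̄`).  Local ingredients of [Wu13]: Howe duality for unitary dual pairs
([GanTakeda2016, Thm. 1.2]; rank one [MVW1987, chap. 3 IV.4]), theta dichotomy ([SunZhu2015, Thm. 1.10]; non-archimedean [GanGrossPrasad2012 ∕ Liu’s GG11]).  NOT the anchor: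
[Liu2021, Cor. B.6 (3)] (multiplicity one `m_cusp(π) = 1`, which print DERIVES from B.6 (1) + Thm. B.4 + dichotomy + Howe duality — the consumer may do the
same) nor Prop. D.4 (1).  Junk: for `P` orthogonal to `S` the hypothesis is false and nothing is claimed; over an `ιA` that is not a frame transport the
predicate speaks of the wrong embedding and is simply not the consumer's instance.  Nothing is asserted in this file.

## References
* [Liu2021] Y. Liu, *Fourier–Jacobi cycles and arithmetic relative trace formula*, Camb. J. Math. 9 (2021) = arXiv:2102.11518: App. B Cor. B.6 (1) and its
  proof (p. 99, l. 4319–4339); Cor. B.6 (3) and its proof (p. 99); proof of Prop. 4.13 Case 1 (p. 48); Thm. B.4 (1) (p. 98).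
* [Wu2013] C. Wu, *Irreducibility of theta lifting for unitary groups*, J. Number Theory 133 (2013) 3296–3318, Thm. 5.1, Thm. 5.3.
* [Rallis1984] S. Rallis, *On the Howe duality conjecture*, Compositio Math. 51 (1984) 333–399, §1.
* [Ichino2004] A. Ichino, *A regularized Siegel–Weil formula for unitary groups*, Math. Z. 247 (2004) 241–277.
* [Moeglin1997] C. Mœglin, *Non nullité de certains relêvements par séries thêta*, J. Lie Theory 7 (1997) 201–229.
* [BorelJacquet1979] A. Borel, H. Jacquet, *Automorphic forms and automorphic representations*, PSPM 33.1 (1979), §4.6.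
* [GanTakeda2016] W. T. Gan, S. Takeda, *A proof of the Howe duality conjecture*, J. AMS 29 (2016), Thm. 1.2.
* [MVW1987] C. Mœglin, M.-F. Vignéras, J.-L. Waldspurger, LNM 1291 (1987), chap. 3 IV.4.
-/

noncomputable section

open NumberField MeasureTheory IsDedekindDomain
open scoped Matrix ComplexOrder ENNReal
open Literature.NumberTheory.Automorphic Literature.NumberTheory.Automorphic.UnitaryGroup
open Literature.NumberTheory.Automorphic.UnitaryGroup.CotangentForms
open Literature.NumberTheory.Automorphic.IdeleClassGroup
open Literature.NumberTheory.Automorphic.Liu2021.Def411WeilCarriers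
open Literature.NumberTheory.Automorphic.Liu2021.Def411WeilCarriersDoubling
open Literature.NumberTheory.GelbartRogawski1991 Literature.NumberTheory.GelbartRogawski1991.UnitaryDualPair
open Literature.NumberTheory.Weil1964
open Literature.RepresentationTheory.Liu2021
open Literature.RepresentationTheory.CompactGroups

namespace Literature.NumberTheory.Automorphic.Liu2021

variable (L : Type) [Field L] [NumberField L] [IsCMField L] (N : ℕ) (H : Matrix (Fin N) (Fin N) L)
  {n' : ℕ} (e₁ : Fin N × Fin 1 ≃ Fin n') (dV : Fin N → L) (hdV : ∀ i, IsCMField.complexConj L (dV i) = dV i)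
  (hdV0 : ∀ i, dV i ≠ 0)
  (ιA : (adelicGroupData (↥(maximalRealSubfield L)) L (IsCMField.complexConj L) N H).Adelic →* ↥(UnitaryGroup.adelic (↥(maximalRealSubfield L)) L (IsCMField.complexConj L) N (Matrix.diagonal dV)))
  [CompactSpace (↥(UnitaryGroup.adelic (↥(maximalRealSubfield L)) L (IsCMField.complexConj L) N (Matrix.diagonal dV)) ⧸ (UnitaryGroup.toAdelic (↥(maximalRealSubfield L)) L (IsCMField.complexConj L) N (Matrix.diagonal dV)).range)]
  (μA : Measure (adelicGroupData (↥(maximalRealSubfield L)) L (IsCMField.complexConj L) N H).automorphicQuotient) [(adelicGroupData (↥(maximalRealSubfield L)) L (IsCMField.complexConj L) N H).IsAutomorphicMeasure μA]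
  (μ : Literature.NumberTheory.Automorphic.IdeleClassGroup L →ₜ* Circle) (hμ : IsConjugateSymplectic L μ) (a : (↥(maximalRealSubfield L))ˣ)
  (ξ : haveI := normal_range_toAdelic_JW L a
    PontryaginDual (↥(UnitaryGroup.adelic (↥(maximalRealSubfield L)) L (IsCMField.complexConj L) 1 (JW (↥(maximalRealSubfield L)) L a)) ⧸ (UnitaryGroup.toAdelic (↥(maximalRealSubfield L)) L (IsCMField.complexConj L) 1 (JW (↥(maximalRealSubfield L)) L a)).range))

/-- **[Liu2021, Cor. B.6 (1), second clause] ∕ [Wu2013, Thm. 5.1] at `(dim W, dim V) = (1, N)`, as a PREDICATE: «a discrete automorphic `P ⊆ L²([U(H)], μA)`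
whose orthogonal projection does not kill every `(a, ξ)`-theta class `[x ↦ Θ̃_Ψ(ξ)(ιA x)]` has its carrier inside the CLOSED SPAN of those classes» — print:
«`V_π = Θ^V_{(μ⁻¹,ν⁻¹),−W}(Θ^W_{(μ,ν),V}(V_π))`» with `Θ^W(V_π)` irreducible, i.e. the line of one automorphic character `ξ₀` of `[U(⟨a⟩)]`, and `ξ₀ = ξ` by the
adjunction `⟨T_Ψ^* f, ξ⟩ = ⟨f, T_Ψ ξ⟩`; `L²`-closure phrasing by [BorelJacquet1979, §4.6].  Inclusion only (print: equality).  Nothing is asserted; a consumer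
closes it over the CM curve frames with the pinned transport `ιA`.
[cite: Liu2021, App. B Cor. B.6 (1) and its proof (p. 99, l. 4319–4339)] [cite: Wu2013, Thm. 5.1] [cite: Rallis1984, §1] [cite: BorelJacquet1979, §4.6] -/
def ThetaLiftFromLineRealises : Prop :=
  letI : MeasurableSpace (↥(UnitaryGroup.adelic (↥(maximalRealSubfield L)) L (IsCMField.complexConj L) 1 (JW (↥(maximalRealSubfield L)) L a)) ⧸ (UnitaryGroup.toAdelic (↥(maximalRealSubfield L)) L (IsCMField.complexConj L) 1 (JW (↥(maximalRealSubfield L)) L a)).range) := borel _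
  haveI := normal_range_toAdelic_JW L a
  ∀ P : DiscreteAutomorphicRep (adelicGroupData (↥(maximalRealSubfield L)) L (IsCMField.complexConj L) N H) μA,
    (∃ (hρ : HasThetaMajorants fun
      (p : ↥(UnitaryGroup.adelic (↥(maximalRealSubfield L)) L (IsCMField.complexConj L) N (Matrix.diagonal dV)) × ↥(UnitaryGroup.adelic (↥(maximalRealSubfield L)) L (IsCMField.complexConj L) 1 (JW (↥(maximalRealSubfield L)) L a))) (Φ : piSchwartzBruhat (↥(maximalRealSubfield L)) (Fin n')) =>
        pairRep (↥(maximalRealSubfield L)) L (IsCMField.complexConj L) N 1 e₁ (Matrix.diagonal dV) (JW (↥(maximalRealSubfield L)) L a)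
          (chiSplittingLine L e₁ dV hdV hdV0 (toHeckeCharacter L μ) (isUnitary_toHeckeCharacter L μ)
            ((isOscillatorChar_toHeckeCharacter_iff μ).mpr hμ) (TW (↥(maximalRealSubfield L)) a)
            (isUnit_det_TW (↥(maximalRealSubfield L)) a) (JW (↥(maximalRealSubfield L)) L a) (JW_eq (↥(maximalRealSubfield L)) L a))
          p Φ)
        (μW : Measure (↥(UnitaryGroup.adelic (↥(maximalRealSubfield L)) L (IsCMField.complexConj L) 1 (JW (↥(maximalRealSubfield L)) L a)) ⧸ (UnitaryGroup.toAdelic (↥(maximalRealSubfield L)) L (IsCMField.complexConj L) 1 (JW (↥(maximalRealSubfield L)) L a)).range)) (_ : IsFiniteMeasure μW)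
        (_ : SMulInvariantMeasure ↥(UnitaryGroup.adelic (↥(maximalRealSubfield L)) L (IsCMField.complexConj L) 1 (JW (↥(maximalRealSubfield L)) L a)) (↥(UnitaryGroup.adelic (↥(maximalRealSubfield L)) L (IsCMField.complexConj L) 1 (JW (↥(maximalRealSubfield L)) L a)) ⧸ (UnitaryGroup.toAdelic (↥(maximalRealSubfield L)) L (IsCMField.complexConj L) 1 (JW (↥(maximalRealSubfield L)) L a)).range) μW)
        (Ψ : piSchwartzBruhat (↥(maximalRealSubfield L)) (Fin n'))
        (hθ : MemLp (toQuotFun (adelicGroupData (↥(maximalRealSubfield L)) L (IsCMField.complexConj L) N H) fun x =>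
          (lineThetaKernelDatum L N e₁ dV hdV hdV0 μ hμ a hρ).thetaLiftFun μW Ψ (charCM ξ) (ιA x)) 2 μA),
        P.space.toSubmodule.starProjection (MemLp.toLp _ hθ) ≠ 0) →
    (P.space.toSubmodule : Set ((adelicGroupData (↥(maximalRealSubfield L)) L (IsCMField.complexConj L) N H).L2 μA)) ⊆ closure (Submodule.span ℂ
        {v : (adelicGroupData (↥(maximalRealSubfield L)) L (IsCMField.complexConj L) N H).L2 μA | ∃ (hρ : HasThetaMajorants fun
      (p : ↥(UnitaryGroup.adelic (↥(maximalRealSubfield L)) L (IsCMField.complexConj L) N (Matrix.diagonal dV)) × ↥(UnitaryGroup.adelic (↥(maximalRealSubfield L)) L (IsCMField.complexConj L) 1 (JW (↥(maximalRealSubfield L)) L a))) (Φ : piSchwartzBruhat (↥(maximalRealSubfield L)) (Fin n')) =>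
        pairRep (↥(maximalRealSubfield L)) L (IsCMField.complexConj L) N 1 e₁ (Matrix.diagonal dV) (JW (↥(maximalRealSubfield L)) L a)
          (chiSplittingLine L e₁ dV hdV hdV0 (toHeckeCharacter L μ) (isUnitary_toHeckeCharacter L μ)
            ((isOscillatorChar_toHeckeCharacter_iff μ).mpr hμ) (TW (↥(maximalRealSubfield L)) a)
            (isUnit_det_TW (↥(maximalRealSubfield L)) a) (JW (↥(maximalRealSubfield L)) L a) (JW_eq (↥(maximalRealSubfield L)) L a))
          p Φ)
        (μW : Measure (↥(UnitaryGroup.adelic (↥(maximalRealSubfield L)) L (IsCMField.complexConj L) 1 (JW (↥(maximalRealSubfield L)) L a)) ⧸ (UnitaryGroup.toAdelic (↥(maximalRealSubfield L)) L (IsCMField.complexConj L) 1 (JW (↥(maximalRealSubfield L)) L a)).range)) (_ : IsFiniteMeasure μW)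
        (_ : SMulInvariantMeasure ↥(UnitaryGroup.adelic (↥(maximalRealSubfield L)) L (IsCMField.complexConj L) 1 (JW (↥(maximalRealSubfield L)) L a)) (↥(UnitaryGroup.adelic (↥(maximalRealSubfield L)) L (IsCMField.complexConj L) 1 (JW (↥(maximalRealSubfield L)) L a)) ⧸ (UnitaryGroup.toAdelic (↥(maximalRealSubfield L)) L (IsCMField.complexConj L) 1 (JW (↥(maximalRealSubfield L)) L a)).range) μW)
        (Ψ : piSchwartzBruhat (↥(maximalRealSubfield L)) (Fin n'))
        (hθ : MemLp (toQuotFun (adelicGroupData (↥(maximalRealSubfield L)) L (IsCMField.complexConj L) N H) fun x =>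
          (lineThetaKernelDatum L N e₁ dV hdV hdV0 μ hμ a hρ).thetaLiftFun μW Ψ (charCM ξ) (ιA x)) 2 μA),
        v = MemLp.toLp _ hθ} : Set ((adelicGroupData (↥(maximalRealSubfield L)) L (IsCMField.complexConj L) N H).L2 μA))

/-- Unfolding of `ThetaLiftFromLineRealises` (`Iff.rfl`). [cite: Liu2021, App. B Cor. B.6 (1) (p. 99)] [cite: Wu2013, Thm. 5.1] -/
theorem thetaLiftFromLineRealises_iff :
    ThetaLiftFromLineRealises L N H e₁ dV hdV hdV0 ιA μA μ hμ a ξ ↔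
      (letI : MeasurableSpace (↥(UnitaryGroup.adelic (↥(maximalRealSubfield L)) L (IsCMField.complexConj L) 1 (JW (↥(maximalRealSubfield L)) L a)) ⧸ (UnitaryGroup.toAdelic (↥(maximalRealSubfield L)) L (IsCMField.complexConj L) 1 (JW (↥(maximalRealSubfield L)) L a)).range) := borel _
  haveI := normal_range_toAdelic_JW L a
  ∀ P : DiscreteAutomorphicRep (adelicGroupData (↥(maximalRealSubfield L)) L (IsCMField.complexConj L) N H) μA,
    (∃ (hρ : HasThetaMajorants fun
      (p : ↥(UnitaryGroup.adelic (↥(maximalRealSubfield L)) L (IsCMField.complexConj L) N (Matrix.diagonal dV)) × ↥(UnitaryGroup.adelic (↥(maximalRealSubfield L)) L (IsCMField.complexConj L) 1 (JW (↥(maximalRealSubfield L)) L a))) (Φ : piSchwartzBruhat (↥(maximalRealSubfield L)) (Fin n')) =>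
        pairRep (↥(maximalRealSubfield L)) L (IsCMField.complexConj L) N 1 e₁ (Matrix.diagonal dV) (JW (↥(maximalRealSubfield L)) L a)
          (chiSplittingLine L e₁ dV hdV hdV0 (toHeckeCharacter L μ) (isUnitary_toHeckeCharacter L μ)
            ((isOscillatorChar_toHeckeCharacter_iff μ).mpr hμ) (TW (↥(maximalRealSubfield L)) a)
            (isUnit_det_TW (↥(maximalRealSubfield L)) a) (JW (↥(maximalRealSubfield L)) L a) (JW_eq (↥(maximalRealSubfield L)) L a))
          p Φ)
        (μW : Measure (↥(UnitaryGroup.adelic (↥(maximalRealSubfield L)) L (IsCMField.complexConj L) 1 (JW (↥(maximalRealSubfield L)) L a)) ⧸ (UnitaryGroup.toAdelic (↥(maximalRealSubfield L)) L (IsCMField.complexConj L) 1 (JW (↥(maximalRealSubfield L)) L a)).range)) (_ : IsFiniteMeasure μW)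
        (_ : SMulInvariantMeasure ↥(UnitaryGroup.adelic (↥(maximalRealSubfield L)) L (IsCMField.complexConj L) 1 (JW (↥(maximalRealSubfield L)) L a)) (↥(UnitaryGroup.adelic (↥(maximalRealSubfield L)) L (IsCMField.complexConj L) 1 (JW (↥(maximalRealSubfield L)) L a)) ⧸ (UnitaryGroup.toAdelic (↥(maximalRealSubfield L)) L (IsCMField.complexConj L) 1 (JW (↥(maximalRealSubfield L)) L a)).range) μW)
        (Ψ : piSchwartzBruhat (↥(maximalRealSubfield L)) (Fin n'))
        (hθ : MemLp (toQuotFun (adelicGroupData (↥(maximalRealSubfield L)) L (IsCMField.complexConj L) N H) fun x =>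
          (lineThetaKernelDatum L N e₁ dV hdV hdV0 μ hμ a hρ).thetaLiftFun μW Ψ (charCM ξ) (ιA x)) 2 μA),
        P.space.toSubmodule.starProjection (MemLp.toLp _ hθ) ≠ 0) →
    (P.space.toSubmodule : Set ((adelicGroupData (↥(maximalRealSubfield L)) L (IsCMField.complexConj L) N H).L2 μA)) ⊆ closure (Submodule.span ℂ
        {v : (adelicGroupData (↥(maximalRealSubfield L)) L (IsCMField.complexConj L) N H).L2 μA | ∃ (hρ : HasThetaMajorants fun
      (p : ↥(UnitaryGroup.adelic (↥(maximalRealSubfield L)) L (IsCMField.complexConj L) N (Matrix.diagonal dV)) × ↥(UnitaryGroup.adelic (↥(maximalRealSubfield L)) L (IsCMField.complexConj L) 1 (JW (↥(maximalRealSubfield L)) L a))) (Φ : piSchwartzBruhat (↥(maximalRealSubfield L)) (Fin n')) =>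
        pairRep (↥(maximalRealSubfield L)) L (IsCMField.complexConj L) N 1 e₁ (Matrix.diagonal dV) (JW (↥(maximalRealSubfield L)) L a)
          (chiSplittingLine L e₁ dV hdV hdV0 (toHeckeCharacter L μ) (isUnitary_toHeckeCharacter L μ)
            ((isOscillatorChar_toHeckeCharacter_iff μ).mpr hμ) (TW (↥(maximalRealSubfield L)) a)
            (isUnit_det_TW (↥(maximalRealSubfield L)) a) (JW (↥(maximalRealSubfield L)) L a) (JW_eq (↥(maximalRealSubfield L)) L a))
          p Φ)
        (μW : Measure (↥(UnitaryGroup.adelic (↥(maximalRealSubfield L)) L (IsCMField.complexConj L) 1 (JW (↥(maximalRealSubfield L)) L a)) ⧸ (UnitaryGroup.toAdelic (↥(maximalRealSubfield L)) L (IsCMField.complexConj L) 1 (JW (↥(maximalRealSubfield L)) L a)).range)) (_ : IsFiniteMeasure μW)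
        (_ : SMulInvariantMeasure ↥(UnitaryGroup.adelic (↥(maximalRealSubfield L)) L (IsCMField.complexConj L) 1 (JW (↥(maximalRealSubfield L)) L a)) (↥(UnitaryGroup.adelic (↥(maximalRealSubfield L)) L (IsCMField.complexConj L) 1 (JW (↥(maximalRealSubfield L)) L a)) ⧸ (UnitaryGroup.toAdelic (↥(maximalRealSubfield L)) L (IsCMField.complexConj L) 1 (JW (↥(maximalRealSubfield L)) L a)).range) μW)
        (Ψ : piSchwartzBruhat (↥(maximalRealSubfield L)) (Fin n'))
        (hθ : MemLp (toQuotFun (adelicGroupData (↥(maximalRealSubfield L)) L (IsCMField.complexConj L) N H) fun x =>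
          (lineThetaKernelDatum L N e₁ dV hdV hdV0 μ hμ a hρ).thetaLiftFun μW Ψ (charCM ξ) (ιA x)) 2 μA),
        v = MemLp.toLp _ hθ} : Set ((adelicGroupData (↥(maximalRealSubfield L)) L (IsCMField.complexConj L) N H).L2 μA))) :=
  Iff.rfl

end Literature.NumberTheory.Automorphic.Liu2021

end
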